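import Literature.IUT.HodgeTheaters.InitialThetaData
import Literature.NumberTheory.EllipticCurves.TateCurve.SplitOfOddTorsion
import Literature.NumberTheory.EllipticCurves.TateCurve.TorsionRootTwoNumberField
import Literature.NumberTheory.EllipticCurves.GaloisActionProofs
import Literature.NumberTheory.EllipticCurves.MultiplicativeReductionJValuationProofs
import HarnessLib

/-!
# Initial Θ-data: `E_F` itself is a Tate curve (SPLIT multiplicative reduction) at every `v ∈ V(F)^bad`
# ([IUTchI] Def. 3.1 (b): "bad [multiplicative] reduction" + "the `2·3`-torsion points of `E_F` are
# rational over `F`" ⟹ split, by the nine `F`-rational `3`-torsion points)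

`Proofs` companion (theorems only; no definitions, no named facts, no instances) of
`Literature.IUT.HodgeTheaters.InitialThetaData` (abc-iut-L5-t2: the REAL [IUTchI] Def. 3.1), by the
cell `abc-iut` (seat abc-iut-L5-t12); sequel of `InitialThetaDataSplitProofs` (same seat), which
treats `E_K = E_F ×_F K` at the places of `K` over `V(F)^bad` through the `l`-torsion of
Def. 3.1 (c). Here the base curve: Mochizuki, *Inter-universal Teichmüller theory I* (kurims
May-2020 manuscript), Def. 3.1 (b) p. 61 asks that "`X_F` has bad [i.e., multiplicative] reduction
at the elements of `V(F)` that lie over `V^bad_mod`" and that "the `2·3`-torsion points of `E_F` are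
rational over `F`", and Def. 3.1 (c) p. 62 then speaks of "the orders [∈ ℤ] of the `q`-parameters
of `E_F` at the primes of `V(F)^bad`". A `q`-parameter `q_v ∈ F_v` exists exactly when the
multiplicative reduction at `v` is SPLIT (Silverman ATAEC Thm. V.5.3); print does not say "split",
but the printed data force it: the `9 > 3` rational points of the odd order `3` exclude the
non-split twist (the tree's `SplitOfOddTorsion`, ATAEC V.5.3 / Cor. V.5.4). This file proves:

* `hasSplitMultiplicativeReductionAt_of_hasMultiplicativeReductionAt_of_rational_odd_torsion`
  (generic): an elliptic curve `E` over a number field `F` with multiplicative reduction at `v` and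
  more than `n` `F`-RATIONAL points killed by an odd `n` has split multiplicative reduction at `v`
  (abc-iut-w5-d047's `one_lt_norm_j_of_hasMultiplicativeReductionAt` + the tree's
  `hasSplitMultiplicativeReductionAt_of_odd_torsion`, with the `F`-points pushed to `F_v`).
* `InitialThetaData.exists_finset_three_torsion` — for `D : InitialThetaData F K Fbar E l Pb`,
  `E_F(F)` contains `9 = 3²` points killed by `3` (Silverman AEC III.6.4 (b) over `F̄`, the tree's
  `card_torsionPoints_eq_sq_holds`, descended by Def. 3.1 (b) `torsion_six_rational`).
* **`InitialThetaData.hasSplitMultiplicativeReductionAt_base_of_mem_VFbad`** — `E_F` has SPLIT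
  multiplicative reduction at every `v ∈ V(F)^bad` (`D.VFbad`).
* **`InitialThetaData.exists_tateParameter_base_of_mem_VFbad`** — hence an honest Tate parameter
  `q_v ∈ F_v` at every `v ∈ V(F)^bad`: `q_v ≠ 0`, `v(q_v) < 1`, `tateJ q_v = j(E_F)`,
  `v(q_v) = v(j(E_F))⁻¹` (i.e. `ord_v q_v = −ord_v j`), `E_F ⊗ F_v ≅_{F_v} E_{q_v}` (the tree's
  UNCONDITIONAL Silverman V.5.3, `exists_tateParameter_valuation_of_hasSplitMultiplicativeReductionAt`)
  — the "`q`-parameters of `E_F` at the primes of `V(F)^bad`" of Def. 3.1 (c) as elements, whose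
  orders abc-iut-L5-t2's `qParamOrd` records through `ord_v(Δ_min)`;
* `InitialThetaData.valued_tateParameter_eq_exp_neg_qParamOrd_of_mem_VFbad` /
  `…log_valued_tateParameter_eq_neg_qParamOrd_of_mem_VFbad` (v2 append) — **`ord_v(q_v) = qParamOrd E v`**:
  the order of the (unique) Tate parameter at `v ∈ V(F)^bad` is `ord_v(Δ_min(E_F))`, so Def. 3.1 (c)'s
  `l_coprime_qParamOrd` is literally "`l` prime to the order of the `q`-parameter" — the docstring
  caveat "Tate uniformisation as a classical FACT" of `qParamOrd` is now a theorem at `V(F)^bad`.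

Nothing of the series is asserted; no side is taken on [IUTchIII] Cor. 3.12.

## References
* [Mochizuki2012] S. Mochizuki, IUT I, Def. 3.1 (b)(c) pp. 61–62.
* [SilvermanATAEC1994] J. H. Silverman, *Advanced Topics in the Arithmetic of Elliptic Curves*,
  GTM 151, Thm. V.5.3 and Cor. V.5.4 (PDF pp. 407–410).
* [SilvermanAEC2009] J. H. Silverman, *The Arithmetic of Elliptic Curves*, 2nd ed., Cor. III.6.4 (b),
  VII.5 Prop. 5.1 (b).
-/

noncomputable section

open scoped Classical
open WeierstrassCurve

namespace Literature.IUT.HodgeTheaters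

open Literature.NumberTheory.EllipticCurves Literature.NumberTheory.EllipticCurves.TateCurve
  Literature.NumberTheory.EllipticCurves.SteinWuthrich2013 NumberField IsDedekindDomain

/-! ### Generic: `F`-rational odd torsion at a multiplicative place -/

section Generic

variable {F : Type} [Field F] [NumberField F] (E : WeierstrassCurve F) [E.IsElliptic]
  (v : HeightOneSpectrum (𝓞 F))

/-- **Multiplicative reduction + more than `n` rational points of odd order `n` ⟹ SPLIT multiplicative
reduction** (Silverman ATAEC Thm. V.5.3 / Cor. V.5.4 with AEC VII.5.1 (b)), for `F`-rational points of
an elliptic curve `E` over a number field `F` at a finite place `v`: `|j(E)|_v > 1` by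
abc-iut-w5-d047's `one_lt_norm_j_of_hasMultiplicativeReductionAt`, the points pushed to `F_v`
(injective `E(F) → E(F_v)`), then the tree's `hasSplitMultiplicativeReductionAt_of_odd_torsion`.
[cite: SilvermanATAEC1994, Thm. V.5.3 and Cor. V.5.4 (PDF pp. 407–410)]
[cite: SilvermanAEC2009, VII.5 Prop. 5.1(b)] -/
theorem hasSplitMultiplicativeReductionAt_of_hasMultiplicativeReductionAt_of_rational_odd_torsion
    (hmult : E.HasMultiplicativeReductionAt v) {n : ℕ} (hn : Odd n)
    (S : Finset (E.toAffine.baseChange F).Point) (hS : ∀ P ∈ S, n • P = 0) (hcard : n < S.card) :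
    E.HasSplitMultiplicativeReductionAt v := by
  let ι : (E.toAffine.baseChange F).Point →+ (E.toAffine.baseChange (v.adicCompletion F)).Point :=
    Affine.Point.map (Algebra.ofId F (v.adicCompletion F))
  have hι : Function.Injective ι := Affine.Point.map_injective _
  refine hasSplitMultiplicativeReductionAt_of_odd_torsion F v E
    (one_lt_norm_j_of_hasMultiplicativeReductionAt F v E hmult) hn (S.map ⟨ι, hι⟩) ?_ ?_
  · intro P hP
    obtain ⟨P₀, hP₀, rfl⟩ := Finset.mem_map.mp hP
    show n • ι P₀ = 0
    rw [← map_nsmul, hS P₀ hP₀, map_zero]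
  · rwa [Finset.card_map]

end Generic

/-! ### For initial Θ-data: `E_F` is a Tate curve at every `v ∈ V(F)^bad` -/

section ThetaData

variable {F K Fbar : Type} [Field F] [NumberField F] [Field K] [NumberField K] [Algebra F K]
  [Field Fbar] [Algebra F Fbar] [Algebra K Fbar] {E : WeierstrassCurve F}
  [E.IsElliptic] {l : ℕ} {Pb : BadPlacePredicates K} (D : InitialThetaData F K Fbar E l Pb)

namespace InitialThetaData

include D

/-- **`E_F(F)` has full `3`-torsion**: nine distinct `F`-points killed by `3` — `#E_F[3](F̄) = 3²`
(Silverman AEC III.6.4 (b); the tree's `card_torsionPoints_eq_sq_holds` over the algebraically closed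
`F̄`) and every `F̄`-point killed by `3` is killed by `6`, hence comes from `E_F(F)` (Def. 3.1 (b)
"the `2·3`-torsion points of `E_F` are rational over `F`", `torsion_six_rational`).
[claim: Mochizuki2012, status: disputed] [cite: SilvermanAEC2009, Cor. III.6.4(b)] -/
theorem exists_finset_three_torsion :
    ∃ S : Finset (E.toAffine.baseChange F).Point, S.card = 9 ∧ ∀ P ∈ S, 3 • P = 0 := by
  haveI := D.isAlgClosure
  haveI : IsAlgClosed Fbar := IsAlgClosure.isAlgClosed F
  haveI : CharZero Fbar := charZero_of_injective_algebraMap (algebraMap F Fbar).injective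
  -- the geometric `3`-torsion: `9` points
  have h9 : Nat.card (torsionPoints E Fbar ((3 : ℕ) : ℤ)) = 3 ^ 2 :=
    card_torsionPoints_eq_sq_holds E Fbar (n := 3) (by norm_num)
  haveI : Finite (torsionPoints E Fbar ((3 : ℕ) : ℤ)) := Nat.finite_of_card_ne_zero (by rw [h9]; norm_num)
  haveI : Fintype (torsionPoints E Fbar ((3 : ℕ) : ℤ)) := Fintype.ofFinite _
  let S₀ : Finset (E.baseChange Fbar).toAffine.Point :=
    Finset.univ.map ⟨((↑) : torsionPoints E Fbar ((3 : ℕ) : ℤ) → (E.baseChange Fbar).toAffine.Point),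
      Subtype.val_injective⟩
  have hS₀card : S₀.card = 9 := by
    rw [Finset.card_map, Finset.card_univ, ← Nat.card_eq_fintype_card, h9]
    norm_num
  have hS₀mem : ∀ x ∈ S₀, (3 : ℤ) • x = 0 := by
    intro x hx
    obtain ⟨y, -, rfl⟩ := Finset.mem_map.mp hx
    exact (mem_torsionPoints_iff E Fbar (y : (E.baseChange Fbar).toAffine.Point)).mp y.2
  -- every such point is `F`-rational (Def. 3.1 (b))
  have hrat : ∀ x ∈ S₀, ∃ P : (E.toAffine.baseChange F).Point,
      Affine.Point.baseChange (W' := E.toAffine) F Fbar P = x := by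
    intro x hx
    have h6 : (6 : ℤ) • x = 0 := by
      rw [show (6 : ℤ) = 2 * 3 by norm_num, mul_zsmul, hS₀mem x hx, zsmul_zero]
    obtain ⟨P, hP⟩ := D.torsion_six_rational x h6
    exact ⟨P, hP⟩
  choose! f hf using hrat
  have hinj : Set.InjOn f S₀ := by
    intro x hx y hy h
    rw [← hf x hx, ← hf y hy, h]
  refine ⟨S₀.image f, ?_, ?_⟩
  · rw [Finset.card_image_of_injOn hinj, hS₀card]
  · intro P hP
    obtain ⟨x, hx, rfl⟩ := Finset.mem_image.mp hP
    apply Affine.Point.map_injective (Algebra.ofId F Fbar)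
    change Affine.Point.baseChange (W' := E.toAffine) F Fbar (3 • f x) =
      Affine.Point.baseChange (W' := E.toAffine) F Fbar 0
    rw [map_nsmul, map_zero, hf x hx, ← natCast_zsmul]
    exact hS₀mem x hx

/-- **[IUTchI] Def. 3.1 (b) ⟹ `E_F` has SPLIT multiplicative reduction at every `v ∈ V(F)^bad`** (over
`F` itself, not only over `K`): multiplicative reduction at `v` (`multiplicative_over_VbadMod`) and the
nine `F`-rational `3`-torsion points (`exists_finset_three_torsion`, `9 > 3`, `3` odd) exclude the
non-split twist (Silverman ATAEC Thm. V.5.3 / Cor. V.5.4, the tree's `SplitOfOddTorsion`).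
[claim: Mochizuki2012, status: disputed] [cite: SilvermanATAEC1994, Thm. V.5.3 and Cor. V.5.4 (PDF pp. 407–410)] -/
theorem hasSplitMultiplicativeReductionAt_base_of_mem_VFbad {v : FinitePlace F} (hv : v ∈ D.VFbad) :
    E.HasSplitMultiplicativeReductionAt v.maximalIdeal := by
  obtain ⟨S, hS, hS3⟩ := D.exists_finset_three_torsion
  exact hasSplitMultiplicativeReductionAt_of_hasMultiplicativeReductionAt_of_rational_odd_torsion E
    v.maximalIdeal (D.multiplicative_over_VbadMod v hv) (by decide : Odd 3) S hS3 (by rw [hS]; norm_num)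

/-- **The `q`-parameter of `E_F` at `v ∈ V(F)^bad` ([IUTchI] Def. 3.1 (c) "the orders of the
`q`-parameters of `E_F` at the primes of `V(F)^bad`") EXISTS in `F_v`**: for initial Θ-data `D` and
`v ∈ V(F)^bad` there is `q_v ∈ F_v` with `q_v ≠ 0`, `v(q_v) < 1`, `tateJ q_v = j(E_F)`,
`v(q_v) = v(j(E_F))⁻¹` (`ord_v q_v = −ord_v j(E_F)`) and an `F_v`-isomorphism
`C • (E_F ⊗ F_v) = E_{q_v}` with the Tate curve — Silverman ATAEC Thm. V.5.3 (UNCONDITIONAL in the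
tree, `exists_tateParameter_valuation_of_hasSplitMultiplicativeReductionAt`) at the split place
supplied by `hasSplitMultiplicativeReductionAt_base_of_mem_VFbad`.
[claim: Mochizuki2012, status: disputed] [cite: SilvermanATAEC1994, Thm. V.5.3 (PDF pp. 407–409)] -/
theorem exists_tateParameter_base_of_mem_VFbad {v : FinitePlace F} (hv : v ∈ D.VFbad) :
    ∃ q : (v.maximalIdeal).adicCompletion F, q ≠ 0 ∧ Valued.v q < 1 ∧
      tateJ q = algebraMap F ((v.maximalIdeal).adicCompletion F) E.j ∧
      Valued.v q = (Valued.v (algebraMap F ((v.maximalIdeal).adicCompletion F) E.j))⁻¹ ∧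
      ∃ C : VariableChange ((v.maximalIdeal).adicCompletion F),
        C • E.baseChange ((v.maximalIdeal).adicCompletion F) = tateCurve q :=
  exists_tateParameter_valuation_of_hasSplitMultiplicativeReductionAt F v.maximalIdeal E
    (D.hasSplitMultiplicativeReductionAt_base_of_mem_VFbad hv)

/-- **`ord_v(q_v) = ord_v(Δ_min)`: the order of the genuine Tate parameter at `v ∈ V(F)^bad` IS
abc-iut-L5-t2's `qParamOrd E v`** (which Def. 3.1 (c)'s clause `l_coprime_qParamOrd` — "`l` is prime
… to the orders of the `q`-parameters of `E_F` at the primes of `V(F)^bad`" — was typed against, via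
`ord_v(Δ_min)` "by Tate's uniformisation as a classical FACT"; here that identification is a THEOREM):
for initial Θ-data `D`, `v ∈ V(F)^bad` and ANY `q ∈ F_v` with `q ≠ 0`, `v(q) < 1`, `tateJ q = j(E_F)`
(such `q` exists, `exists_tateParameter_base_of_mem_VFbad`, and is unique, Silverman ATAEC Lemma
V.5.1 `tateParameter_unique`), `v(q) = exp(−qParamOrd E v)`, i.e. `ord_v(q) = ord_v(Δ_min(E_F))`
(`v(q) = v(j)⁻¹` and `v(j) = exp(ord_v Δ_min)` at a multiplicative place, Silverman AEC VII.5.1 (b),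
the tree's `valuation_j_eq_exp_ordMinimalDiscriminant_of_hasMultiplicativeReductionAt`).
[claim: Mochizuki2012, status: disputed] [cite: SilvermanATAEC1994, Lemma V.5.1 and Thm. V.5.3 (PDF pp. 406–409)]
[cite: SilvermanAEC2009, Prop. VII.5.1(b)] -/
theorem valued_tateParameter_eq_exp_neg_qParamOrd_of_mem_VFbad {v : FinitePlace F} (hv : v ∈ D.VFbad)
    {q : (v.maximalIdeal).adicCompletion F} (hq0 : q ≠ 0) (hq : Valued.v q < 1)
    (hqj : tateJ q = algebraMap F ((v.maximalIdeal).adicCompletion F) E.j) :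
    Valued.v q = WithZero.exp (-(qParamOrd E v.maximalIdeal : ℤ)) := by
  letI := Literature.NumberTheory.GaloisRepresentations.Ultrametric.AdicCompletion.nontriviallyNormedField
    F v.maximalIdeal
  haveI := charZero_adicCompletion' F v.maximalIdeal
  haveI : (E.baseChange ((v.maximalIdeal).adicCompletion F)).IsElliptic :=
    inferInstanceAs (E.map (algebraMap F ((v.maximalIdeal).adicCompletion F))).IsElliptic
  obtain ⟨q', hq0', hq', hqj', hv', -⟩ := D.exists_tateParameter_base_of_mem_VFbad hv
  have hjE : (E.baseChange ((v.maximalIdeal).adicCompletion F)).j =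
      algebraMap F ((v.maximalIdeal).adicCompletion F) E.j := E.map_j _
  -- uniqueness of the Tate parameter (ATAEC Lemma V.5.1)
  have hqq : q = q' :=
    tateParameter_unique (E := E.baseChange ((v.maximalIdeal).adicCompletion F)) hq0
      (Valued.toNormedField.norm_lt_one_iff.mpr hq) (hqj.trans hjE.symm) hq0'
      (Valued.toNormedField.norm_lt_one_iff.mpr hq') (hqj'.trans hjE.symm)
  rw [hqq, hv', WeierstrassCurve.valued_algebraMap_adicCompletion,
    E.valuation_j_eq_exp_ordMinimalDiscriminant_of_hasMultiplicativeReductionAt v.maximalIdeal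
      (D.multiplicative_over_VbadMod v hv), WithZero.exp_neg]
  rfl

/-- **Integer form: `log v(q_v) = −qParamOrd E v`** (`ord_v(q_v) = qParamOrd E v` with
`ord_v := −log ∘ v`, the convention of `Literature.IUT.LogVolume.ord`), for the Tate parameter at
`v ∈ V(F)^bad`; so Def. 3.1 (c)'s `D.l_coprime_qParamOrd` reads "`l` is prime to `ord_v(q_v)`" for the
genuine `q`-parameter `q_v ∈ F_v` of `E_F`. [claim: Mochizuki2012, status: disputed]
[cite: SilvermanATAEC1994, Lemma V.5.1 and Thm. V.5.3 (PDF pp. 406–409)] -/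
theorem log_valued_tateParameter_eq_neg_qParamOrd_of_mem_VFbad {v : FinitePlace F} (hv : v ∈ D.VFbad)
    {q : (v.maximalIdeal).adicCompletion F} (hq0 : q ≠ 0) (hq : Valued.v q < 1)
    (hqj : tateJ q = algebraMap F ((v.maximalIdeal).adicCompletion F) E.j) :
    WithZero.log (Valued.v q) = -(qParamOrd E v.maximalIdeal : ℤ) := by
  rw [D.valued_tateParameter_eq_exp_neg_qParamOrd_of_mem_VFbad hv hq0 hq hqj, WithZero.log_exp]

end InitialThetaData

end ThetaData

end Literature.IUT.HodgeTheaters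

end
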